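import Mathlib
import HarnessLib
import Summits.CriticalPhenomena.PercolationContinuityZ3.Theses.PercTreeValue
import Literature.Probability.Percolation.TwoPointFunction
import Literature.Probability.Percolation.RSW

/-!
# `stub_restrictionPositivity_of_boxRestriction` — link L2 of line `Sketch` (rev c2)
# (crux `TetrahedronDisjointCoexistence`, stmt-CriticalPhenomena-7798)

Registered link stub L2 of the lead's skeleton `Cruxes/TetrahedronDisjointCoexistence/Lines/Sketch.lean`
(rev c2), landed DEF-FREE over tree declarations.

With `a_r = (r,r,0)` and `k = ⌊r/8⌋`: BOX RESTRICTION (the open stub `stub_boxRestriction` of line `Sketch`,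
`P(0 ↔ a_r inside Box_r) ≥ c τ(0,a_r)` for the box `Box_r = [−r, 2r]² × [−2r, 3k]`, S5') implies the
half-space RESTRICTION POSITIVITY `stub_restrictionPositivity` (S12 of line `SketchIdeator2`, verbatim
conclusion, `H_r = {x | 2x₂ + 2 ≤ r}`), with `c₁ := c` and `r₀ ↦ max r₀ 2`.

Proof. For `r ≥ 2` one has `2 · (3⌊r/8⌋) + 2 ≤ r` (for `r ∈ [2,7]`, `k = 0`; for `r ≥ 8`,
`6k + 2 ≤ 8k ≤ r`), hence `Box_r ⊆ H_r`; restricted connection events are monotone in the region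
(`openConnIn_mono`) and the measure is monotone (`measureReal_mono`).
-/

noncomputable section

namespace Summit.CriticalPhenomena.PercolationContinuityZ3.Theorems.TetrahedronDisjointCoexistence

open MeasureTheory
open Literature.Probability.Percolation Literature.Probability.LatticeModels

/-- For `r ≥ 2` the box `Box_r = [−r, 2r]² × [−2r, 3k]`, `k = ⌊r/8⌋`, lies in the half-space
`H_r = {x | 2x₂ + 2 ≤ r}` (indeed `6⌊r/8⌋ + 2 ≤ r` for `r ≥ 2`). -/
theorem linkBoxPositivity_box_subset_halfSpace (r : ℕ) (hr : 2 ≤ r) :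
    {x : Site 3 | -(r : ℤ) ≤ x 0 ∧ x 0 ≤ 2 * (r : ℤ) ∧ -(r : ℤ) ≤ x 1 ∧ x 1 ≤ 2 * (r : ℤ) ∧
        -(2 * (r : ℤ)) ≤ x 2 ∧ x 2 ≤ 3 * ((r : ℤ) / 8)} ⊆
      {x : Site 3 | 2 * x 2 + 2 ≤ (r : ℤ)} := by
  intro x hx
  simp only [Set.mem_setOf_eq] at hx ⊢
  have hr' : (2 : ℤ) ≤ (r : ℤ) := by exact_mod_cast hr
  omega

/-- **Link L2 (registered stub of line `Sketch`, rev c2).** Box restriction implies the half-space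
RESTRICTION POSITIVITY `stub_restrictionPositivity` (S12 of line `SketchIdeator2`, verbatim conclusion):
since `Box_r ⊆ H_r = {x | 2x₂ + 2 ≤ r}` for `r ≥ 2`, `P(0 ↔_{H_r} a_r) ≥ P(0 ↔_{Box_r} a_r) ≥ c τ(0,a_r)`;
take `c₁ := c`, `r₀ ↦ max r₀ 2`. -/
theorem stub_restrictionPositivity_of_boxRestriction
    (hBox : ∃ c : ℝ, 0 < c ∧ ∃ r₀ : ℕ, ∀ r : ℕ, r₀ ≤ r →
      c * tau 3 (criticalProbI 3) 0 ![(r : ℤ), (r : ℤ), 0] ≤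
        (bondPercolation (zdGraph 3) (criticalProbI 3)).real
          (openConnIn
            {x : Site 3 | -(r : ℤ) ≤ x 0 ∧ x 0 ≤ 2 * (r : ℤ) ∧ -(r : ℤ) ≤ x 1 ∧ x 1 ≤ 2 * (r : ℤ) ∧
              -(2 * (r : ℤ)) ≤ x 2 ∧ x 2 ≤ 3 * ((r : ℤ) / 8)}
            (0 : Site 3) ![(r : ℤ), (r : ℤ), 0])) :
    ∃ c₁ : ℝ, 0 < c₁ ∧ ∃ r₀ : ℕ, ∀ r : ℕ, r₀ ≤ r →
      c₁ * tau 3 (criticalProbI 3) 0 ![(r : ℤ), (r : ℤ), 0] ≤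
        (bondPercolation (zdGraph 3) (criticalProbI 3)).real
          (openConnIn {x : Site 3 | 2 * x 2 + 2 ≤ (r : ℤ)} (0 : Site 3) ![(r : ℤ), (r : ℤ), 0]) := by
  obtain ⟨c, hc, r₀, hC⟩ := hBox
  refine ⟨c, hc, max r₀ 2, fun r hr => ?_⟩
  have hr₀ : r₀ ≤ r := le_trans (le_max_left _ _) hr
  have hr2 : 2 ≤ r := le_trans (le_max_right _ _) hr
  exact le_trans (hC r hr₀)
    (measureReal_mono (openConnIn_mono (linkBoxPositivity_box_subset_halfSpace r hr2) _ _))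

end Summit.CriticalPhenomena.PercolationContinuityZ3.Theorems.TetrahedronDisjointCoexistence

end
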